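import Literature.MathematicalPhysics.QuantumFieldTheory.Balaban1983to89.Node00.Record13SepCoPInhabitedOfClassC1
import Literature.MathematicalPhysics.QuantumFieldTheory.Balaban1983to89.Node00.Record12BgRowCoClassCPMFloorB
import Literature.MathematicalPhysics.QuantumFieldTheory.Balaban1983to89.Node00.LargeFieldBackgroundCoPOfRecordB
import Literature.MathematicalPhysics.QuantumFieldTheory.Balaban1983to89.Node00.Record13ReverseComparabilityOfBetaBox

/-!
# NODE 00 (YM-PLAN Track A) — STAGE 13, v1.5 `CoP`: THE FACT-KEYED K0 CLOSERS (plan's Cut B) AT `θ₁₅ᶜᶜ¹` ON THE GUARDED [15] THEOREM-1 SENTENCE OVER PRINT's (2.3) DATUM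
# `VariationalThm1RegSepCoP7MGB F N Adm (lamDatum F) (dataSmall7PTopOf F N) B₃ a₀ a₁` (k0-s1-w1 S1a-C `Record12BgRowCoClassCPMFloorB`: [15] Thm 1 (8) for `bd`-minimisers over print's class ON
# THE SUPPORT DOMAIN, guard `Adm`) — node00-def-R's LINCHPIN (FILE 16b, Cut A at print's datum) ∘ S1a-C's pointwise accessor at node00-def-R's print-datum background `UbgMSCoPOfRecordB` (S2b) ∘
# FILE 14d's β-box clause

Cell `pub-ymgap`, seat `pub-ymgap-node00-def-K0a` (g7: FILE 16c; g10: STAGE-2 RE-KEY).  [15] = [Balaban1985Variational], [6] = [Balaban1985RegularSpaces], [II] = [Balaban1984PropagatorsII],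
[III] = [Balaban1988Convergent], [I] = [Balaban1987RG1].

STAGE-2 RE-KEY (2026-08-30; (E1) variant (iii-b) of record, director-ym №343 (D5)∕(D6), №345, №350; seat node00-def-K0a g10): «(E1) Stage-2 coherence re-key to print's (2.3) datum (FLAG №16 ∕ LOCATE-HSEAM 5d3298b8d191f169); the (b)-keyed text survives in git history».  After the `Record13CoP` seam re-point `UbgOfRecord₁₃CoP (n+1) = UbgMSCoPOfRecordB …` (node00-def-R) every hypothesis of this file is READ AT PRINT's DATUM, token for token: (8) `VariationalThm1RegSepCoP7M F N B₃ a₀ a₁` ↦ `VariationalThm1RegSepCoP7MGB F N Adm (lamDatum F) (dataSmall7PTopOf F N) B₃ a₀ a₁` (guard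
`Adm : StepGuard F` GENERIC, discharged per prefix at the witness family by the displayed `hAdm`, k0-s1-w1's all-torus convention); the solvable set `solvableDom … (genSet s.Ω n)` ↦ `solvableDomB …
(lamBondsSeq s.Ω n)`; the background `UbgMSCoPOfRecord` ↦ `UbgMSCoPOfRecordB` and its spec `isMinimizer_UbgMSCoPOfRecord` ↦ `isMinimizerB_UbgMSCoPOfRecordB` (node00-def-R S2b); node00-def-P11's
record-level supplier `plaqSmallOn_UbgMSCoPOfRecord_of_thm1RegSepCoP7M` ↦ S1a-C's pointwise `plaqSmallOn_of_thm1RegSepTop7MGB` ∘ `isMinimizerB_UbgMSCoPOfRecordB` (two terms, inlined — k0-s1-w1's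
`…GuardedBRowLam` names the composite but imports this file's cone).  Every declaration NAME and every conclusion SHAPE is unchanged; FILE 16b's re-keyed `exists_k0SepCoP_of_classBounds` is
consumed by name.

WHAT THIS FILE PROVES (theorems only; 0 `def`).
* ★★★ `classC0CoP_theta13OfThm1CC1_of_thm1RegSepCoP7M (hB hB' ha₀ ha₁) (h15 : VariationalThm1RegSepCoP7MGB F N Adm (lamDatum F) (dataSmall7PTopOf F N) B₃ a₀ a₁) (hAdm) (hmono) (hcompRev)` — the
  Pos-shaped (scales ≥ 1) guarded C⁰ clause over the v1.5 range, at `UbgMSCoPOfRecordB` on the solvable set of print's datum.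
* ★★★★★ `exists_k0SepCoP_of_thm1RegSepCoP7M (F) (signs) (h15) (hAdm) (hmono) (hcompRev) (hclassC1)`.
* ★★★★★★ `exists_k0SepCoP_of_thm1RegSepCoP7M_of_betaBox (F) (signs) (h15) (hAdm) (hb : 0 ≤ b) (hlow : FlowStep.BetaLowerH b ½ β₁₃(θ₁₅ᶜᶜ¹)) (hup : FlowStep.BetaUpperH β′ ½ β₁₃(θ₁₅ᶜᶜ¹)) (hβ′ : β′ ≤ 3) (hclassC1)`.

HONEST FRAMING.  Composition of tree theorems; CONDITIONAL on the DISPLAYED named fact `VariationalThm1RegSepCoP7MGB … (lamDatum F) …` (a `Prop` with parameters, NEVER asserted), its guard's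
discharge `hAdm`, the β-box resp. history clauses, and the guarded C¹ clause; nothing of Bałaban asserted; NOT a discharge; K0 NOT closed here; counts unmoved (typed 28∕28 · discharged 8∕28); one
finite 𝕋⁴ programme at fixed ε — NOT continuum ∕ OS ∕ mass gap ∕ Clay.  No `sorry`, `axiom`, `def`, `instance`, `notation`.
-/

noncomputable section

open MeasureTheory
open scoped Matrix.Norms.L2Operator

namespace Literature.MathematicalPhysics.QuantumFieldTheory.Balaban1983to89.Node00

open T4Continuum B14.Eq218Concrete B15DeterminingSets B15DeterminingSetsB B12RegularSpaces111 B14RegularSpaces234 B14Radii T4AxialGaugeSmallField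

/-! ## Plan's Cut B under v1.5 `CoP` AT PRINT's DATUM: the Pos-shaped guarded C⁰ clause AT `θ₁₅ᶜᶜ¹` FROM `VariationalThm1RegSepCoP7MGB … (lamDatum F) …` + the history clauses ∕ the β-box; the K0 body -/

section FromFactSepCoP

variable {F : T4Family} {N : ℕ} [NeZero N] {ε₀ ε₂₉ B₃ B₃' a₀ a₁ : ℝ}

/-- **★★★ THE GUARDED C⁰ CLASS CLAUSE (scales `1 ≤ m ≤ n`) OVER THE v1.5 RANGE AT `θ₁₅ᶜᶜ¹` FROM THE GUARDED [15] THEOREM-1 SENTENCE OVER PRINT's DATUM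
`VariationalThm1RegSepCoP7MGB F N Adm (lamDatum F) (dataSmall7PTopOf F N) B₃ a₀ a₁`** ([15] Thm 1 (8) for minimisers over print's class (6) ON THE SUPPORT DOMAIN `suppDomOfRecord` determined on
[II] (2.3)'s bond datum `Λ({Ω_j(s)}) = lamBondsSeq s.Ω n`, thresholds comparable both ways, `0 < M₁`, prefix guard `Adm` — NEVER asserted), **ITS GUARD AT THE WITNESS FAMILY (`hAdm`) AND THE TWO
HISTORY CLAUSES** (hmono ⇒ `ε_m ≤ 2ε_{m+1}` by 13b; hcompRev by 14d): S1a-C's pointwise accessor `plaqSmallOn_of_thm1RegSepTop7MGB` at node00-def-R's print-datum background through its spec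
`isMinimizerB_UbgMSCoPOfRecordB … hsol` (S2b), fed with 13b's `hnum_`∕`εreg_le_`∕`hcomp_…_of_monotone`, its conclusion on `Sect2.omegaPlaqsTop … m` rewritten to `omegaPlaqs s.Ω m` at `m ≥ 1`
(`Sect2.omegaPlaqsTop_of_ne_zero`).  CONDITIONAL; nothing of Bałaban asserted. [cite: Balaban1985Variational, (6)–(7) p.278, Thm 1 (2),(8) p.279, p.304 lines 1–2; Balaban1985RegularSpaces, (1.3)–(1.9) p.77; Balaban1984PropagatorsII, (2.3) p.224; Balaban1988Convergent, (2.4)–(2.8) pp.255–256, (2.10) p.256, (2.12)–(2.13) p.256, p.255, p.259] -/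
theorem classC0CoP_theta13OfThm1CC1_of_thm1RegSepCoP7M (hB : 0 ≤ B₃) (hB' : 0 ≤ B₃') (ha₀ : 0 < a₀) (ha₁ : 0 < a₁) {Adm : StepGuard F}
    (h15 : VariationalThm1RegSepCoP7MGB F N Adm (lamDatum F) (dataSmall7PTopOf F N) B₃ a₀ a₁)
    (hAdm : ∀ (p : B12.RunParams) (n : ℕ) (s : SeqOfRecord F (theta13OfThm1CC1 F N ε₀ ε₂₉ B₃ B₃' a₀ a₁).ν (theta13OfThm1CC1 F N ε₀ ε₂₉ B₃ B₃' a₀ a₁).τ9.M (gOfRecord₁₃ F N (theta13OfThm1CC1 F N ε₀ ε₂₉ B₃ B₃' a₀ a₁) p) p.K n), 1 ≤ n → n ≤ p.K →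
      Step.InInterval (theta13OfThm1CC1 F N ε₀ ε₂₉ B₃ B₃' a₀ a₁).γ n (gOfRecord₁₃ F N (theta13OfThm1CC1 F N ε₀ ε₂₉ B₃ B₃' a₀ a₁) p) → PartCompat₁₃ F N (theta13OfThm1CC1 F N ε₀ ε₂₉ B₃ B₃' a₀ a₁) p n → Adm (theta13OfThm1CC1 F N ε₀ ε₂₉ B₃ B₃' a₀ a₁).ν (theta13OfThm1CC1 F N ε₀ ε₂₉ B₃ B₃' a₀ a₁).τ9.M (gOfRecord₁₃ F N (theta13OfThm1CC1 F N ε₀ ε₂₉ B₃ B₃' a₀ a₁) p) p.K n s)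
    (hmono : ∀ (p : B12.RunParams) (n : ℕ), n ≤ p.K → Step.InInterval (theta13OfThm1CC1 F N ε₀ ε₂₉ B₃ B₃' a₀ a₁).γ n (gOfRecord₁₃ F N (theta13OfThm1CC1 F N ε₀ ε₂₉ B₃ B₃' a₀ a₁) p) → ∀ m, m < n →
      gOfRecord₁₃ F N (theta13OfThm1CC1 F N ε₀ ε₂₉ B₃ B₃' a₀ a₁) p m ≤ gOfRecord₁₃ F N (theta13OfThm1CC1 F N ε₀ ε₂₉ B₃ B₃' a₀ a₁) p (m + 1))
    (hcompRev : ∀ (p : B12.RunParams) (n : ℕ), n ≤ p.K → Step.InInterval (theta13OfThm1CC1 F N ε₀ ε₂₉ B₃ B₃' a₀ a₁).γ n (gOfRecord₁₃ F N (theta13OfThm1CC1 F N ε₀ ε₂₉ B₃ B₃' a₀ a₁) p) → ∀ m, m < n →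
      (theta13OfThm1CC1 F N ε₀ ε₂₉ B₃ B₃' a₀ a₁).s2.cR * epsOfRecord (theta13OfThm1CC1 F N ε₀ ε₂₉ B₃ B₃' a₀ a₁).ν (gOfRecord₁₃ F N (theta13OfThm1CC1 F N ε₀ ε₂₉ B₃ B₃' a₀ a₁) p) (m + 1) ≤ 2 * ((theta13OfThm1CC1 F N ε₀ ε₂₉ B₃ B₃' a₀ a₁).s2.cR * epsOfRecord (theta13OfThm1CC1 F N ε₀ ε₂₉ B₃ B₃' a₀ a₁).ν (gOfRecord₁₃ F N (theta13OfThm1CC1 F N ε₀ ε₂₉ B₃ B₃' a₀ a₁) p) m)) :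
    ∀ (p : B12.RunParams) (n : ℕ), n ≤ p.K → Step.InInterval (theta13OfThm1CC1 F N ε₀ ε₂₉ B₃ B₃' a₀ a₁).γ n (gOfRecord₁₃ F N (theta13OfThm1CC1 F N ε₀ ε₂₉ B₃ B₃' a₀ a₁) p) → PartCompat₁₃ F N (theta13OfThm1CC1 F N ε₀ ε₂₉ B₃ B₃' a₀ a₁) p n →
      ∀ s : SeqOfRecord F (theta13OfThm1CC1 F N ε₀ ε₂₉ B₃ B₃' a₀ a₁).ν (theta13OfThm1CC1 F N ε₀ ε₂₉ B₃ B₃' a₀ a₁).τ9.M (gOfRecord₁₃ F N (theta13OfThm1CC1 F N ε₀ ε₂₉ B₃ B₃' a₀ a₁) p) p.K n, Sect2.SeqSeparated (theta13OfThm1CC1 F N ε₀ ε₂₉ B₃ B₃' a₀ a₁).ν.M₁ s → ∀ W : MSField (F.P p.K) (SU N),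
      W ∈ suppOfRecord₁₃P F N (theta13OfThm1CC1 F N ε₀ ε₂₉ B₃ B₃' a₀ a₁) p n s → Sect2.DataSmall7PTop (avOfRecord F N p.K) s.Ω (suppDomOfRecord F (theta13OfThm1CC1 F N ε₀ ε₂₉ B₃ B₃' a₀ a₁).ν p.K s.Ω) n (fun j => (theta13OfThm1CC1 F N ε₀ ε₂₉ B₃ B₃' a₀ a₁).s2.cR * epsOfRecord (theta13OfThm1CC1 F N ε₀ ε₂₉ B₃ B₃' a₀ a₁).ν (gOfRecord₁₃ F N (theta13OfThm1CC1 F N ε₀ ε₂₉ B₃ B₃' a₀ a₁) p) j) W →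
      W ∈ solvableDomB (avOfRecord F N p.K) (regMSCoPOfRecord F N (theta13OfThm1CC1 F N ε₀ ε₂₉ B₃ B₃' a₀ a₁).ν p.K n s.Ω) (lamBondsSeq s.Ω n) →
      ∀ m, 1 ≤ m → m ≤ n → PlaqSmallOn (omegaPlaqs s.Ω m) (B₃ * ((theta13OfThm1CC1 F N ε₀ ε₂₉ B₃ B₃' a₀ a₁).s2.cR * epsOfRecord (theta13OfThm1CC1 F N ε₀ ε₂₉ B₃ B₃' a₀ a₁).ν (gOfRecord₁₃ F N (theta13OfThm1CC1 F N ε₀ ε₂₉ B₃ B₃' a₀ a₁) p) m) * (F.P p.K).eta m ^ 2)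
        (UbgMSCoPOfRecordB F N (theta13OfThm1CC1 F N ε₀ ε₂₉ B₃ B₃' a₀ a₁).ν (theta13OfThm1CC1 F N ε₀ ε₂₉ B₃ B₃' a₀ a₁).τ9.M (gOfRecord₁₃ F N (theta13OfThm1CC1 F N ε₀ ε₂₉ B₃ B₃' a₀ a₁) p) p.K n s W) := by
  intro p n hn hw hpc s hsep W _ h7 hsol m h1 hm
  have h := plaqSmallOn_of_thm1RegSepTop7MGB h15 (theta13OfThm1CC1 F N ε₀ ε₂₉ B₃ B₃' a₀ a₁).ν (theta13OfThm1CC1 F N ε₀ ε₂₉ B₃ B₃' a₀ a₁).τ9.M (gOfRecord₁₃ F N (theta13OfThm1CC1 F N ε₀ ε₂₉ B₃ B₃' a₀ a₁) p) p.K n (theta13OfThm1CC1 F N ε₀ ε₂₉ B₃ B₃' a₀ a₁).s2.cR s hsep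
    (by rw [theta13OfThm1CC1_M₁]; exact Nat.one_pos) (hAdm p n s (h1.trans hm) hn hw hpc) (hnum_theta13OfThm1CC1 hB hB' ha₀ ha₁ p n hn hw) εreg_le_theta13OfThm1CC1
    (hcomp_theta13OfThm1CC1_of_monotone hB hB' ha₀.le ha₁.le hmono p n hn hw) (hcompRev p n hn hw) h7
    (isMinimizerB_UbgMSCoPOfRecordB (theta13OfThm1CC1 F N ε₀ ε₂₉ B₃ B₃' a₀ a₁).ν (theta13OfThm1CC1 F N ε₀ ε₂₉ B₃ B₃' a₀ a₁).τ9.M (gOfRecord₁₃ F N (theta13OfThm1CC1 F N ε₀ ε₂₉ B₃ B₃' a₀ a₁) p) p.K n s hsol) m hm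
  rwa [Sect2.omegaPlaqsTop_of_ne_zero _ _ (Nat.one_le_iff_ne_zero.mp h1)] at h

/-- **★★★★★ THE v1.5 K0 BODY FOR `F` AT `N = 2` FROM THE GUARDED [15]-FACT INSTANCE OVER PRINT's DATUM `VariationalThm1RegSepCoP7MGB F 2 Adm (lamDatum F) (dataSmall7PTopOf F 2) B₃ a₀ a₁` ((8) ⇒ the
guarded C⁰ clause, ★★★), ITS GUARD AT THE WITNESS FAMILY, THE TWO HISTORY CLAUSES AND THE GUARDED C¹ CLASS CLAUSE (hclassC1, (9)–(10), read at `UbgMSCoPOfRecordB` on print's solvable set)** —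
FILE 16b's Cut A (node00-def-R's Stage-2 re-key) ∘ ★★★.  CONDITIONAL — nothing of Bałaban asserted; K0 NOT closed here. [cite: Balaban1985Variational, (6)–(7) p.278, Thm 1 (8)–(10) p.279, p.304 lines 1–2; Balaban1985RegularSpaces, (1.3)–(1.9) p.77; Balaban1984PropagatorsII, (2.3) p.224; Balaban1988Convergent, Thm 1 p.262, (2.4)–(2.8) pp.255–256, (2.10) p.256, (2.12)–(2.13) p.256, (2.27)–(2.28) p.259, (2.34)–(2.41) p.261, (3.16)–(3.22) pp.268–269; Balaban1989LargeFieldI, (0.3)–(0.4) p.176] -/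
theorem exists_k0SepCoP_of_thm1RegSepCoP7M (F : T4Family) (hε : 0 < ε₀) (hε' : 0 < ε₂₉) (hB : 0 ≤ B₃) (hB' : 0 ≤ B₃') (ha₀ : 0 < a₀) (ha₁ : 0 < a₁) {Adm : StepGuard F}
    (h15 : VariationalThm1RegSepCoP7MGB F 2 Adm (lamDatum F) (dataSmall7PTopOf F 2) B₃ a₀ a₁)
    (hAdm : ∀ (p : B12.RunParams) (n : ℕ) (s : SeqOfRecord F (theta13OfThm1CC1 F 2 ε₀ ε₂₉ B₃ B₃' a₀ a₁).ν (theta13OfThm1CC1 F 2 ε₀ ε₂₉ B₃ B₃' a₀ a₁).τ9.M (gOfRecord₁₃ F 2 (theta13OfThm1CC1 F 2 ε₀ ε₂₉ B₃ B₃' a₀ a₁) p) p.K n), 1 ≤ n → n ≤ p.K →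
      Step.InInterval (theta13OfThm1CC1 F 2 ε₀ ε₂₉ B₃ B₃' a₀ a₁).γ n (gOfRecord₁₃ F 2 (theta13OfThm1CC1 F 2 ε₀ ε₂₉ B₃ B₃' a₀ a₁) p) → PartCompat₁₃ F 2 (theta13OfThm1CC1 F 2 ε₀ ε₂₉ B₃ B₃' a₀ a₁) p n → Adm (theta13OfThm1CC1 F 2 ε₀ ε₂₉ B₃ B₃' a₀ a₁).ν (theta13OfThm1CC1 F 2 ε₀ ε₂₉ B₃ B₃' a₀ a₁).τ9.M (gOfRecord₁₃ F 2 (theta13OfThm1CC1 F 2 ε₀ ε₂₉ B₃ B₃' a₀ a₁) p) p.K n s)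
    (hmono : ∀ (p : B12.RunParams) (n : ℕ), n ≤ p.K → Step.InInterval (theta13OfThm1CC1 F 2 ε₀ ε₂₉ B₃ B₃' a₀ a₁).γ n (gOfRecord₁₃ F 2 (theta13OfThm1CC1 F 2 ε₀ ε₂₉ B₃ B₃' a₀ a₁) p) → ∀ m, m < n →
      gOfRecord₁₃ F 2 (theta13OfThm1CC1 F 2 ε₀ ε₂₉ B₃ B₃' a₀ a₁) p m ≤ gOfRecord₁₃ F 2 (theta13OfThm1CC1 F 2 ε₀ ε₂₉ B₃ B₃' a₀ a₁) p (m + 1))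
    (hcompRev : ∀ (p : B12.RunParams) (n : ℕ), n ≤ p.K → Step.InInterval (theta13OfThm1CC1 F 2 ε₀ ε₂₉ B₃ B₃' a₀ a₁).γ n (gOfRecord₁₃ F 2 (theta13OfThm1CC1 F 2 ε₀ ε₂₉ B₃ B₃' a₀ a₁) p) → ∀ m, m < n →
      (theta13OfThm1CC1 F 2 ε₀ ε₂₉ B₃ B₃' a₀ a₁).s2.cR * epsOfRecord (theta13OfThm1CC1 F 2 ε₀ ε₂₉ B₃ B₃' a₀ a₁).ν (gOfRecord₁₃ F 2 (theta13OfThm1CC1 F 2 ε₀ ε₂₉ B₃ B₃' a₀ a₁) p) (m + 1) ≤ 2 * ((theta13OfThm1CC1 F 2 ε₀ ε₂₉ B₃ B₃' a₀ a₁).s2.cR * epsOfRecord (theta13OfThm1CC1 F 2 ε₀ ε₂₉ B₃ B₃' a₀ a₁).ν (gOfRecord₁₃ F 2 (theta13OfThm1CC1 F 2 ε₀ ε₂₉ B₃ B₃' a₀ a₁) p) m))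
    (hclassC1 : ∀ (p : B12.RunParams) (n : ℕ), n ≤ p.K → Step.InInterval (theta13OfThm1CC1 F 2 ε₀ ε₂₉ B₃ B₃' a₀ a₁).γ n (gOfRecord₁₃ F 2 (theta13OfThm1CC1 F 2 ε₀ ε₂₉ B₃ B₃' a₀ a₁) p) → PartCompat₁₃ F 2 (theta13OfThm1CC1 F 2 ε₀ ε₂₉ B₃ B₃' a₀ a₁) p n →
      ∀ s : SeqOfRecord F (theta13OfThm1CC1 F 2 ε₀ ε₂₉ B₃ B₃' a₀ a₁).ν (theta13OfThm1CC1 F 2 ε₀ ε₂₉ B₃ B₃' a₀ a₁).τ9.M (gOfRecord₁₃ F 2 (theta13OfThm1CC1 F 2 ε₀ ε₂₉ B₃ B₃' a₀ a₁) p) p.K n, Sect2.SeqSeparated (theta13OfThm1CC1 F 2 ε₀ ε₂₉ B₃ B₃' a₀ a₁).ν.M₁ s → ∀ W : MSField (F.P p.K) (SU 2),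
      W ∈ suppOfRecord₁₃P F 2 (theta13OfThm1CC1 F 2 ε₀ ε₂₉ B₃ B₃' a₀ a₁) p n s → Sect2.DataSmall7PTop (avOfRecord F 2 p.K) s.Ω (suppDomOfRecord F (theta13OfThm1CC1 F 2 ε₀ ε₂₉ B₃ B₃' a₀ a₁).ν p.K s.Ω) n (fun j => (theta13OfThm1CC1 F 2 ε₀ ε₂₉ B₃ B₃' a₀ a₁).s2.cR * epsOfRecord (theta13OfThm1CC1 F 2 ε₀ ε₂₉ B₃ B₃' a₀ a₁).ν (gOfRecord₁₃ F 2 (theta13OfThm1CC1 F 2 ε₀ ε₂₉ B₃ B₃' a₀ a₁) p) j) W →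
      W ∈ solvableDomB (avOfRecord F 2 p.K) (regMSCoPOfRecord F 2 (theta13OfThm1CC1 F 2 ε₀ ε₂₉ B₃ B₃' a₀ a₁).ν p.K n s.Ω) (lamBondsSeq s.Ω n) →
      ∀ m, 1 ≤ m → m ≤ n → PlaqC1SmallOn (plaqInside (s.Ω m)) (B₃' * ((theta13OfThm1CC1 F 2 ε₀ ε₂₉ B₃ B₃' a₀ a₁).s2.cR * epsOfRecord (theta13OfThm1CC1 F 2 ε₀ ε₂₉ B₃ B₃' a₀ a₁).ν (gOfRecord₁₃ F 2 (theta13OfThm1CC1 F 2 ε₀ ε₂₉ B₃ B₃' a₀ a₁) p) m) * (F.P p.K).eta m ^ 3)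
        (UbgMSCoPOfRecordB F 2 (theta13OfThm1CC1 F 2 ε₀ ε₂₉ B₃ B₃' a₀ a₁).ν (theta13OfThm1CC1 F 2 ε₀ ε₂₉ B₃ B₃' a₀ a₁).τ9.M (gOfRecord₁₃ F 2 (theta13OfThm1CC1 F 2 ε₀ ε₂₉ B₃ B₃' a₀ a₁) p) p.K n s W)) :
    ∃ θ : Stage13Params F 2, θ.Provisos₁₃SepCoP F 2 ∧ (θ.ZtUnity F 2 ∧ θ.SlotsNondegenerate₁₃ F 2) ∧ θ.Admissible F 2 :=
  exists_k0SepCoP_of_classBounds F hε hε' hB hB' ha₀ ha₁ (classC0CoP_theta13OfThm1CC1_of_thm1RegSepCoP7M hB hB' ha₀ ha₁ h15 hAdm hmono hcompRev) hclassC1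

/-- **★★★★★★ THE v1.5 K0 BODY FOR `F` FROM THE GUARDED FACT INSTANCE OVER PRINT's DATUM, ITS GUARD AT THE WITNESS FAMILY, THE β-BOX LEAF AND THE GUARDED C¹ CLAUSE** — both history clauses from
`FlowStep.BetaLowerH b ½ (betaOfRecord₁₃ F 2 θ₁₅ᶜᶜ¹)`, `0 ≤ b` (13e) and `FlowStep.BetaUpperH β′ ½ (betaOfRecord₁₃ F 2 θ₁₅ᶜᶜ¹)`, `β′ ≤ 3` (14d): plan's Cut B = (i) `VariationalThm1RegSepCoP7MGB F 2 Adm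
(lamDatum F) (dataSmall7PTopOf F 2) B₃ a₀ a₁` + `hAdm`, (ii) the β-box leaf, (iii) the guarded C¹ class clause.  CONDITIONAL — nothing of Bałaban asserted; K0 NOT closed here. [cite: Balaban1985Variational, (6)–(7) p.278, Thm 1 (8)–(10) p.279; Balaban1987RG1, (0.20) p.256, Thm 2 p.259, §1 p.264; Balaban1984PropagatorsII, (2.3) p.224; Balaban1988Convergent, Thm 1 p.262, (2.4)–(2.8) pp.255–256, (2.12)–(2.13) p.256, (2.27)–(2.28) p.259, (2.34)–(2.41) p.261, (3.16)–(3.22) pp.268–269; Balaban1989LargeFieldI, (0.3)–(0.4) p.176] -/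
theorem exists_k0SepCoP_of_thm1RegSepCoP7M_of_betaBox (F : T4Family) (hε : 0 < ε₀) (hε' : 0 < ε₂₉) (hB : 0 ≤ B₃) (hB' : 0 ≤ B₃') (ha₀ : 0 < a₀) (ha₁ : 0 < a₁) {Adm : StepGuard F}
    (h15 : VariationalThm1RegSepCoP7MGB F 2 Adm (lamDatum F) (dataSmall7PTopOf F 2) B₃ a₀ a₁)
    (hAdm : ∀ (p : B12.RunParams) (n : ℕ) (s : SeqOfRecord F (theta13OfThm1CC1 F 2 ε₀ ε₂₉ B₃ B₃' a₀ a₁).ν (theta13OfThm1CC1 F 2 ε₀ ε₂₉ B₃ B₃' a₀ a₁).τ9.M (gOfRecord₁₃ F 2 (theta13OfThm1CC1 F 2 ε₀ ε₂₉ B₃ B₃' a₀ a₁) p) p.K n), 1 ≤ n → n ≤ p.K →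
      Step.InInterval (theta13OfThm1CC1 F 2 ε₀ ε₂₉ B₃ B₃' a₀ a₁).γ n (gOfRecord₁₃ F 2 (theta13OfThm1CC1 F 2 ε₀ ε₂₉ B₃ B₃' a₀ a₁) p) → PartCompat₁₃ F 2 (theta13OfThm1CC1 F 2 ε₀ ε₂₉ B₃ B₃' a₀ a₁) p n → Adm (theta13OfThm1CC1 F 2 ε₀ ε₂₉ B₃ B₃' a₀ a₁).ν (theta13OfThm1CC1 F 2 ε₀ ε₂₉ B₃ B₃' a₀ a₁).τ9.M (gOfRecord₁₃ F 2 (theta13OfThm1CC1 F 2 ε₀ ε₂₉ B₃ B₃' a₀ a₁) p) p.K n s)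
    {b β' : ℝ} (hb : 0 ≤ b) (hlow : FlowStep.BetaLowerH b (1 / 2) (betaOfRecord₁₃ F 2 (theta13OfThm1CC1 F 2 ε₀ ε₂₉ B₃ B₃' a₀ a₁)))
    (hup : FlowStep.BetaUpperH β' (1 / 2) (betaOfRecord₁₃ F 2 (theta13OfThm1CC1 F 2 ε₀ ε₂₉ B₃ B₃' a₀ a₁))) (hβ' : β' ≤ 3)
    (hclassC1 : ∀ (p : B12.RunParams) (n : ℕ), n ≤ p.K → Step.InInterval (theta13OfThm1CC1 F 2 ε₀ ε₂₉ B₃ B₃' a₀ a₁).γ n (gOfRecord₁₃ F 2 (theta13OfThm1CC1 F 2 ε₀ ε₂₉ B₃ B₃' a₀ a₁) p) → PartCompat₁₃ F 2 (theta13OfThm1CC1 F 2 ε₀ ε₂₉ B₃ B₃' a₀ a₁) p n →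
      ∀ s : SeqOfRecord F (theta13OfThm1CC1 F 2 ε₀ ε₂₉ B₃ B₃' a₀ a₁).ν (theta13OfThm1CC1 F 2 ε₀ ε₂₉ B₃ B₃' a₀ a₁).τ9.M (gOfRecord₁₃ F 2 (theta13OfThm1CC1 F 2 ε₀ ε₂₉ B₃ B₃' a₀ a₁) p) p.K n, Sect2.SeqSeparated (theta13OfThm1CC1 F 2 ε₀ ε₂₉ B₃ B₃' a₀ a₁).ν.M₁ s → ∀ W : MSField (F.P p.K) (SU 2),
      W ∈ suppOfRecord₁₃P F 2 (theta13OfThm1CC1 F 2 ε₀ ε₂₉ B₃ B₃' a₀ a₁) p n s → Sect2.DataSmall7PTop (avOfRecord F 2 p.K) s.Ω (suppDomOfRecord F (theta13OfThm1CC1 F 2 ε₀ ε₂₉ B₃ B₃' a₀ a₁).ν p.K s.Ω) n (fun j => (theta13OfThm1CC1 F 2 ε₀ ε₂₉ B₃ B₃' a₀ a₁).s2.cR * epsOfRecord (theta13OfThm1CC1 F 2 ε₀ ε₂₉ B₃ B₃' a₀ a₁).ν (gOfRecord₁₃ F 2 (theta13OfThm1CC1 F 2 ε₀ ε₂₉ B₃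 B₃' a₀ a₁) p) j) W →
      W ∈ solvableDomB (avOfRecord F 2 p.K) (regMSCoPOfRecord F 2 (theta13OfThm1CC1 F 2 ε₀ ε₂₉ B₃ B₃' a₀ a₁).ν p.K n s.Ω) (lamBondsSeq s.Ω n) →
      ∀ m, 1 ≤ m → m ≤ n → PlaqC1SmallOn (plaqInside (s.Ω m)) (B₃' * ((theta13OfThm1CC1 F 2 ε₀ ε₂₉ B₃ B₃' a₀ a₁).s2.cR * epsOfRecord (theta13OfThm1CC1 F 2 ε₀ ε₂₉ B₃ B₃' a₀ a₁).ν (gOfRecord₁₃ F 2 (theta13OfThm1CC1 F 2 ε₀ ε₂₉ B₃ B₃' a₀ a₁) p) m) * (F.P p.K).eta m ^ 3)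
        (UbgMSCoPOfRecordB F 2 (theta13OfThm1CC1 F 2 ε₀ ε₂₉ B₃ B₃' a₀ a₁).ν (theta13OfThm1CC1 F 2 ε₀ ε₂₉ B₃ B₃' a₀ a₁).τ9.M (gOfRecord₁₃ F 2 (theta13OfThm1CC1 F 2 ε₀ ε₂₉ B₃ B₃' a₀ a₁) p) p.K n s W)) :
    ∃ θ : Stage13Params F 2, θ.Provisos₁₃SepCoP F 2 ∧ (θ.ZtUnity F 2 ∧ θ.SlotsNondegenerate₁₃ F 2) ∧ θ.Admissible F 2 :=
  exists_k0SepCoP_of_thm1RegSepCoP7M F hε hε' hB hB' ha₀ ha₁ h15 hAdm (hmono_theta13OfThm1CC1_of_betaLowerH hb hlow)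
    (hcompRev_theta13OfThm1CC1_of_betaBox hB hB' ha₀.le ha₁.le hb hlow hup hβ') hclassC1

end FromFactSepCoP

end Literature.MathematicalPhysics.QuantumFieldTheory.Balaban1983to89.Node00

end
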